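import Summits.QuantumAdvantage.QuantumAdvantage.Theorems.CharDialPlaneDivAscentC1
import HarnessLib

/-!
# HyperplaneLemma — PART C2 of PlaneDivAscent (continuation of Part C1; see its module docstring)
(cell decomp-qadv, lens 6, g21 REV2; tree-ready, Prop-definition-free.)  §3 of the hyperplane lemma:
bivariate Lagrange interpolation `interp₂`, power sums, and «all line sums zero ⇒ total degree ≤ p - 2»
(`td_interp₂`), plus the coordinate form `hl2_coord` of the two-variable hyperplane lemma.
-/

set_option autoImplicit false

namespace Summit.QuantumAdvantage.AdviceFreeQNC0.PlaneDiv.HL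

open Polynomial Finset

variable {p : ℕ} [Fact p.Prime]

/-- `1 ≤ p - 1` for a prime `p`. -/
theorem one_le_p_sub_one : 1 ≤ p - 1 := by
  have := (Fact.out : p.Prime).two_le; omega

/-- `δ_c(x) = 1 - (x - c)^(p-1)`, the indicator of `x = c`. -/
noncomputable def δ (c : ZMod p) : Polynomial (ZMod p) := 1 - (X - C c) ^ (p - 1)

/-- `δ c` is the indicator of the point `c`: it evaluates to `1` at `c` and to `0` elsewhere. -/
theorem eval_δ (c x : ZMod p) : (δ c).eval x = if x = c then 1 else 0 := by
  unfold δ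
  simp only [eval_sub, eval_one, eval_pow, eval_X, eval_C]
  split_ifs with h
  · subst h
    rw [sub_self, zero_pow (by have := @one_le_p_sub_one p _; omega), sub_zero]
  · rw [ZMod.pow_card_sub_one_eq_one (sub_ne_zero.mpr h), sub_self]

/-- `δ c` has degree `≤ p - 1`. -/
theorem natDegree_δ_le (c : ZMod p) : (δ c).natDegree ≤ p - 1 := by
  unfold δ
  refine (natDegree_sub_le _ _).trans (max_le (by simp) ?_)
  refine natDegree_pow_le.trans ?_
  rw [natDegree_X_sub_C]; simp

/-- Univariate interpolant. -/
noncomputable def interp (f : ZMod p → ZMod p) : Polynomial (ZMod p) :=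
  ∑ c : ZMod p, C (f c) * δ c

/-- The univariate interpolant `interp g` agrees with `g` everywhere on `𝔽_p`. -/
theorem eval_interp (f : ZMod p → ZMod p) (x : ZMod p) : (interp f).eval x = f x := by
  unfold interp
  rw [eval_finsetSum]
  simp only [eval_mul, eval_C, eval_δ, mul_ite, mul_one, mul_zero]
  simp

/-- The univariate interpolant has degree `≤ p - 1`. -/
theorem natDegree_interp_le (f : ZMod p → ZMod p) : (interp f).natDegree ≤ p - 1 := by
  unfold interp
  apply natDegree_sum_le_of_forall_le
  intro c _
  exact (natDegree_C_mul_le _ _).trans (natDegree_δ_le c)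

/-- Bivariate interpolant of `G : 𝔽_p → 𝔽_p → 𝔽_p`. -/
noncomputable def interp₂ (G : ZMod p → ZMod p → ZMod p) : Polynomial (Polynomial (ZMod p)) :=
  ∑ c : ZMod p, C (interp (fun a => G a c)) * (δ c).map C

/-- `ev` of a polynomial in the outer variable with constant coefficients is its evaluation at `b`. -/
theorem ev_map_C (q : Polynomial (ZMod p)) (a b : ZMod p) : ev (q.map C) a b = q.eval b := by
  rw [ev_def, Polynomial.map_map]
  have : (evalRingHom a).comp C = RingHom.id (Polynomial (ZMod p) →+* Polynomial (ZMod p) |>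
      fun _ => ZMod p) := by ext r; simp
  rw [this, Polynomial.map_id]

/-- The bivariate interpolant `interp₂ G` agrees with `G` everywhere on `𝔽_p²`. -/
theorem ev_interp₂ (G : ZMod p → ZMod p → ZMod p) (a b : ZMod p) :
    ev (interp₂ G) a b = G a b := by
  unfold interp₂
  rw [ev_sum]
  simp only [ev_mul, ev_C, eval_interp, ev_map_C, eval_δ, mul_ite, mul_one, mul_zero]
  simp

/-- The bivariate interpolant has outer degree `≤ p - 1`. -/
theorem natDegree_interp₂_le (G : ZMod p → ZMod p → ZMod p) :
    (interp₂ G).natDegree ≤ p - 1 := by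
  unfold interp₂
  apply natDegree_sum_le_of_forall_le
  intro c _
  exact (natDegree_C_mul_le _ _).trans (natDegree_map_le.trans (natDegree_δ_le c))

/-- Every coefficient polynomial of the bivariate interpolant has degree `≤ p - 1`. -/
theorem natDegree_coeff_interp₂_le (G : ZMod p → ZMod p → ZMod p) (j : ℕ) :
    ((interp₂ G).coeff j).natDegree ≤ p - 1 := by
  unfold interp₂
  rw [finsetSum_coeff]
  apply natDegree_sum_le_of_forall_le
  intro c _
  rw [coeff_C_mul, coeff_map]
  exact (natDegree_mul_C_le _ _).trans (natDegree_interp_le _)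

/-! ### Power sums over `𝔽_p` -/

/-- `Σ_{t ∈ 𝔽_p} t^e = 0` for `e < p - 1`. -/
theorem powSum_of_lt {e : ℕ} (he : e < p - 1) : ∑ t : ZMod p, t ^ e = 0 := by
  apply FiniteField.sum_pow_lt_card_sub_one
  rw [ZMod.card]; exact he

/-- Power sums over `𝔽_p`: `Σ_t t^e = 0` for `0 < e < p - 1`. -/
theorem powSum_of_pos {e : ℕ} (he : 1 ≤ e) :
    ∑ t : ZMod p, t ^ e = if p - 1 ∣ e then -1 else 0 := by
  classical
  have h := FiniteField.sum_pow_units (K := ZMod p) e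
  rw [ZMod.card] at h
  rw [← h]
  let φ : (ZMod p)ˣ ↪ ZMod p := ⟨fun x ↦ x, Units.val_injective⟩
  have hmap : univ.map φ = univ \ {0} := by
    ext x
    simp only [mem_map, mem_univ, Function.Embedding.coeFn_mk, true_and, mem_sdiff,
      mem_singleton, φ]
    constructor
    · rintro ⟨u, rfl⟩; exact u.ne_zero
    · intro hx; exact ⟨Units.mk0 x hx, rfl⟩
  calc ∑ x : ZMod p, x ^ e = ∑ x ∈ univ \ {(0 : ZMod p)}, x ^ e := by
        rw [← sum_sdiff ({0} : Finset (ZMod p)).subset_univ, sum_singleton,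
          zero_pow (by omega), add_zero]
    _ = ∑ x : (ZMod p)ˣ, (x : ZMod p) ^ e := by
        rw [← hmap, sum_map]; rfl

/-- Power sums over `𝔽_p`: `Σ_t t^e = 0` for `e < p - 1` (including `e = 0`, where the sum is `p = 0`). -/
theorem powSum_eq_zero {e : ℕ} (h : e = 0 ∨ ¬ p - 1 ∣ e) : ∑ t : ZMod p, t ^ e = 0 := by
  rcases Nat.eq_zero_or_pos e with he | he
  · exact powSum_of_lt (by rw [he]; exact one_le_p_sub_one)
  · rw [powSum_of_pos he, if_neg]
    rcases h with h | h
    · omega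
    · exact h

/-- Power sums over `𝔽_p`: `Σ_t t^(p-1) = -1`. -/
theorem powSum_eq_neg_one {e : ℕ} (he : 1 ≤ e) (hd : p - 1 ∣ e) : ∑ t : ZMod p, t ^ e = -1 := by
  rw [powSum_of_pos he, if_pos hd]

/-- `(j choose m) ≠ 0` in `𝔽_p` for `m ≤ j < p`. -/
theorem choose_ne_zero {j m : ℕ} (hmj : m ≤ j) (hjp : j < p) : ((j.choose m : ℕ) : ZMod p) ≠ 0 := by
  rw [Ne, ZMod.natCast_eq_zero_iff]
  intro hdvd
  have hP : p.Prime := Fact.out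
  have h1 : j.choose m ∣ j.factorial := by
    have := Nat.choose_mul_factorial_mul_factorial hmj
    exact Dvd.intro _ (by rw [mul_assoc] at this; exact this)
  have h2 : p ∣ j.factorial := dvd_trans hdvd h1
  rw [hP.dvd_factorial] at h2
  omega

/-! ### Degree `≤ p - 2` from vanishing line sums -/

/-- Main degree lemma: if all line sums of `G` in directions `(1, l)` vanish, the bivariate
interpolant has total degree ≤ `p - 2`. -/
theorem td_interp₂ {G : ZMod p → ZMod p → ZMod p}
    (hls : ∀ c l : ZMod p, ∑ t : ZMod p, G t (c + l * t) = 0) :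
    ∀ j, (interp₂ G).coeff j ≠ 0 → ((interp₂ G).coeff j).natDegree + j ≤ p - 2 := by
  have hP : p.Prime := Fact.out
  have hp2 : 2 ≤ p := hP.two_le
  set P := interp₂ G with hPdef
  have hPnat : P.natDegree ≤ p - 1 := natDegree_interp₂_le G
  have hPjnat : ∀ j, (P.coeff j).natDegree ≤ p - 1 := natDegree_coeff_interp₂_le G
  -- notation
  set a : ℕ → ℕ → ZMod p := fun i j => (P.coeff j).coeff i with hadef
  set τ : ℕ → ℕ → ZMod p := fun j k => ∑ t : ZMod p, t ^ k * (P.coeff j).eval t with hτdef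
  -- Step A: expansion of ev
  have hexp : ∀ t b : ZMod p, ev P t b = ∑ j ∈ range p, (P.coeff j).eval t * b ^ j := by
    intro t b
    rw [ev_def, eval_eq_sum_range' (n := p)]
    · simp only [coeff_map, coe_evalRingHom]
    · exact lt_of_le_of_lt (natDegree_map_le.trans hPnat) (by omega)
  -- Step B: the c-polynomial Φ l vanishes
  have hΦ : ∀ l : ZMod p, (∑ j ∈ range p, ∑ m ∈ range (j + 1),
      C (l ^ (j - m) * ((j.choose m : ℕ) : ZMod p) * τ j (j - m)) * X ^ m :
        Polynomial (ZMod p)) = 0 := by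
    intro l
    apply poly_eq_zero_of_eval
    · refine lt_of_le_of_lt (natDegree_sum_le_of_forall_le (n := p - 1) _ _ ?_) (by omega)
      intro j hj
      apply natDegree_sum_le_of_forall_le
      intro m hm
      refine (natDegree_C_mul_X_pow_le _ _).trans ?_
      simp only [mem_range] at hj hm; omega
    · intro c
      rw [eval_finsetSum]
      simp only [eval_finsetSum, eval_mul, eval_C, eval_X_pow]
      -- RHS computation: the line sum
      have hsum := hls c l
      have : ∑ t : ZMod p, G t (c + l * t) =
          ∑ j ∈ range p, ∑ m ∈ range (j + 1),
            l ^ (j - m) * ((j.choose m : ℕ) : ZMod p) * τ j (j - m) * c ^ m := by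
        have step1 : ∀ t : ZMod p, G t (c + l * t) =
            ∑ j ∈ range p, ∑ m ∈ range (j + 1),
              (P.coeff j).eval t * (c ^ m * (l * t) ^ (j - m) * ((j.choose m : ℕ) : ZMod p)) := by
          intro t
          rw [← ev_interp₂ G t (c + l * t), ← hPdef, hexp]
          refine sum_congr rfl fun j _ => ?_
          rw [add_pow, mul_sum]
        simp_rw [step1]
        rw [sum_comm]
        refine sum_congr rfl fun j _ => ?_
        rw [sum_comm]
        refine sum_congr rfl fun m _ => ?_
        rw [hτdef]
        simp only [sum_mul, mul_sum]
        refine sum_congr rfl fun t _ => ?_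
        ring
      rw [← this]; exact hsum
  -- Step C/D: for each e, the l-polynomial Ψ e vanishes
  have hΦcoeff : ∀ l : ZMod p, ∀ e : ℕ,
      ∑ j ∈ range p, (if e ∈ range (j + 1) then
        l ^ (j - e) * ((j.choose e : ℕ) : ZMod p) * τ j (j - e) else 0) = 0 := by
    intro l e
    have h := congrArg (fun Q : Polynomial (ZMod p) => Q.coeff e) (hΦ l)
    simp only [finsetSum_coeff, coeff_C_mul_X_pow, coeff_zero] at h
    refine Eq.trans ?_ h
    refine sum_congr rfl fun j _ => ?_
    exact (sum_ite_eq (range (j + 1)) e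
      (fun m => l ^ (j - m) * ((j.choose m : ℕ) : ZMod p) * τ j (j - m))).symm
  have hΨ : ∀ e : ℕ, (∑ j ∈ range p, (if e ∈ range (j + 1) then
      C (((j.choose e : ℕ) : ZMod p) * τ j (j - e)) * X ^ (j - e) else 0) :
        Polynomial (ZMod p)) = 0 := by
    intro e
    apply poly_eq_zero_of_eval
    · refine lt_of_le_of_lt (natDegree_sum_le_of_forall_le (n := p - 1) _ _ ?_) (by omega)
      intro j hj
      split_ifs
      · refine (natDegree_C_mul_X_pow_le _ _).trans ?_
        simp only [mem_range] at hj; omega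
      · simp
    · intro l
      rw [eval_finsetSum, ← hΦcoeff l e]
      refine sum_congr rfl fun j _ => ?_
      split_ifs
      · simp only [eval_mul, eval_C, eval_X_pow]; ring
      · simp
  -- Step E: τ j k = 0 for k ≤ j < p
  have hτ : ∀ j, j < p → ∀ k, k ≤ j → τ j k = 0 := by
    intro j hj k hk
    have h := congrArg (fun Q : Polynomial (ZMod p) => Q.coeff k) (hΨ (j - k))
    simp only [finsetSum_coeff, coeff_zero] at h
    rw [sum_eq_single_of_mem j (mem_range.mpr hj)] at h
    · rw [if_pos (mem_range.mpr (by omega)), coeff_C_mul_X_pow, if_pos (by omega)] at h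
      have hj' : j - (j - k) = k := by omega
      rw [hj'] at h
      rcases mul_eq_zero.mp h with h | h
      · exact absurd h (choose_ne_zero (by omega) hj)
      · exact h
    · intro j' hj' hne
      split_ifs with h1
      · rw [coeff_C_mul_X_pow, if_neg]
        intro h2
        apply hne
        simp only [mem_range] at h1
        omega
      · simp
  -- Step F: τ j k in terms of coefficients and power sums
  have hτa : ∀ j k, τ j k = ∑ i ∈ range p, a i j * ∑ t : ZMod p, t ^ (i + k) := by
    intro j k
    rw [hτdef]
    simp only []
    have hev : ∀ t : ZMod p, (P.coeff j).eval t = ∑ i ∈ range p, a i j * t ^ i := by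
      intro t
      rw [eval_eq_sum_range' (n := p) (lt_of_le_of_lt (hPjnat j) (by omega))]
    simp_rw [hev, mul_sum]
    rw [sum_comm]
    refine sum_congr rfl fun i _ => ?_
    refine sum_congr rfl fun t _ => ?_
    ring
  -- Step G/H: evaluate τ
  have hS0 : ∀ i k, i < p → k ≤ p - 2 → i ≠ p - 1 - k → ∑ t : ZMod p, t ^ (i + k) = 0 := by
    intro i k hi hk hne
    apply powSum_eq_zero
    by_cases h0 : i + k = 0
    · exact Or.inl h0
    · right
      rintro ⟨c, hc⟩
      rcases Nat.lt_or_ge c 2 with hc2 | hc2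
      · interval_cases c <;> omega
      · have : (p - 1) * c ≥ (p - 1) * 2 := Nat.mul_le_mul_left _ hc2
        omega
  have hτ1 : ∀ j k, k ≤ p - 2 → τ j k = - a (p - 1 - k) j := by
    intro j k hk
    rw [hτa, sum_eq_single_of_mem (p - 1 - k) (mem_range.mpr (by omega))]
    · have : p - 1 - k + k = p - 1 := by omega
      rw [this, powSum_eq_neg_one one_le_p_sub_one (dvd_refl _)]
      ring
    · intro i hi hne
      rw [hS0 i k (mem_range.mp hi) hk hne, mul_zero]
  have hτ2 : ∀ j, τ j (p - 1) = - a 0 j - a (p - 1) j := by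
    intro j
    rw [hτa, sum_eq_add_of_mem 0 (p - 1) (mem_range.mpr (by omega)) (mem_range.mpr (by omega))
      (by omega)]
    · rw [zero_add, powSum_eq_neg_one one_le_p_sub_one (dvd_refl _)]
      have : p - 1 + (p - 1) = (p - 1) * 2 := by ring
      rw [this, powSum_eq_neg_one (by have := @one_le_p_sub_one p _; omega)
        (Dvd.intro 2 rfl)]
      ring
    · rintro i hi ⟨hi0, hi1⟩
      have hip := mem_range.mp hi
      rw [powSum_eq_zero, mul_zero]
      right
      rintro ⟨c, hc⟩
      rcases Nat.lt_or_ge c 2 with hc2 | hc2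
      · interval_cases c <;> omega
      · have : (p - 1) * c ≥ (p - 1) * 2 := Nat.mul_le_mul_left _ hc2
        omega
  -- Step I: coefficients vanish in the top range
  have ha : ∀ i j, i < p → j < p → p - 1 ≤ i + j → a i j = 0 := by
    have hpos : ∀ i j, 1 ≤ i → i < p → j < p → p - 1 ≤ i + j → a i j = 0 := by
      intro i j hi1 hip hjp hij
      have h := hτ j hjp (p - 1 - i) (by omega)
      rw [hτ1 j (p - 1 - i) (by omega)] at h
      have : p - 1 - (p - 1 - i) = i := by omega
      rw [this, neg_eq_zero] at h
      exact h
    intro i j hip hjp hij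
    rcases Nat.eq_zero_or_pos i with hi | hi
    · subst hi
      have hj : j = p - 1 := by omega
      subst hj
      have h := hτ (p - 1) (by omega) (p - 1) le_rfl
      rw [hτ2, hpos (p - 1) (p - 1) one_le_p_sub_one (by omega) (by omega) (by omega),
        sub_zero, neg_eq_zero] at h
      exact h
    · exact hpos i j hi hip hjp hij
  -- Step J: conclude total degree ≤ p - 2
  intro j hj
  have hjp : j < p := by
    by_contra hcon
    apply hj
    exact coeff_eq_zero_of_natDegree_lt (by omega)
  have hcoefN : ∀ N, p - 1 ≤ N + j → (P.coeff j).coeff N = 0 := by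
    intro N hN
    rcases Nat.lt_or_ge N p with hNp | hNp
    · exact ha N j hNp hjp hN
    · exact coeff_eq_zero_of_natDegree_lt (by have := hPjnat j; omega)
  have hjp2 : j ≤ p - 2 := by
    by_contra hcon
    apply hj
    ext N
    rw [coeff_zero]
    exact hcoefN N (by omega)
  have hdeg : (P.coeff j).natDegree ≤ p - 2 - j := by
    rw [natDegree_le_iff_coeff_eq_zero]
    intro N hN
    exact hcoefN N (by omega)
  omega

/-- **HL(2) in coordinates.** A function on `𝔽_p²` all of whose line sums in directions
`(1, l)` vanish and which vanishes on `p - 1` lines `b = μ_i + ν_i a` with pairwise distinct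
parameters is identically zero. -/
theorem hl2_coord (G : ZMod p → ZMod p → ZMod p)
    (hls : ∀ c l : ZMod p, ∑ t : ZMod p, G t (c + l * t) = 0)
    (L : Fin (p - 1) → ZMod p × ZMod p) (hL : Function.Injective L)
    (hvan : ∀ i a, G a ((L i).1 + (L i).2 * a) = 0) : ∀ a b, G a b = 0 := by
  have hp2 : 2 ≤ p := (Fact.out : p.Prime).two_le
  have hTD := td_interp₂ hls
  have hlen : p - 2 + 1 = p - 1 := by omega
  have hzero : interp₂ G = 0 := by
    refine eq_zero_of_lines (p - 2) (interp₂ G) hTD (by omega) (fun i => L (Fin.cast hlen i))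
      (fun i j h => ?_) ?_
    · have := hL h
      exact Fin.cast_injective hlen this |> fun h' => by simpa using h'
    · intro i a
      rw [ev_interp₂]
      exact hvan _ a
  intro a b
  rw [← ev_interp₂ G a b, hzero, ev_zero]

end Summit.QuantumAdvantage.AdviceFreeQNC0.PlaneDiv.HL
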